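import Mathlib
import HarnessLib
import HarnessLib.Audit
import Summits.CriticalPhenomena.Statement
import Literature.Probability.Percolation.CardyFormula
import Literature.Probability.Percolation.SmirnovTheorem
import Literature.Probability.Percolation.SmirnovContinuumLimit
import Literature.Barriers.CriticalPhenomena.CoveringLatticeShift
import Summits.CriticalPhenomena.CardyFormulaZ2.Theorems.UnionJackBeffaraUnionJackEndgame
import Summits.CriticalPhenomena.CardyFormulaZ2.Theorems.UnionJackBeffaraCoveringBridge
import HarnessLib.Audit.Status.Attr

/-!
Route: DWavePairKernel

DORMANT since 2026-08-24T15:48:23Z (reconciler: no traction for 6.9 d (last activity item-evidence-added at 2026-08-17T18:15:54Z); parked, not closed — `ledger route dormant route-CriticalPhenomena-DWavePairKernel --off` to reactivate) — unstaffed, not closed; items shared with open routes are served there. `ledger route dormant <id> --off` reactivates.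

# Route DWavePairKernel — bond-Z2 sits on the nodal line of a d-wave pair kernel — Beffara's
interpolation Walsh-expanded at the colour-symmetric point of the centred square lattice

It suffices to show X = SymmetricPointFlatness ∧ UnionJackCardy (card
dwave-pair-kernel-nodal-line-2, spine). Setting: Beffara's
mixed site percolation P_(1/2,q) = prodBernoulli (mixedParam q) on the centred square lattice G_s
(tree: MixedSite, mixedParam; type I =
ℤ² sites at 1/2, type II face centres at q, type III at 1 − q), in the covering-adapted embedding
and crude discretisation of route
UnionJackBeffara (its `let Z G P` copied verbatim, so q = 0 and q = 1 are the two Kesten encodings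
of bond-ℤ² at p = 1/2 and q = 1/2 is
critical site percolation on G_s). For a conformal rectangle R and mesh δ the map g(q) = P_q[crude
crossing of R] is a POLYNOMIAL in q;
write it at the colour-symmetric point q = 1/2 + h, where the colour flip is a symmetry of the SAME
measure: its Taylor = Fourier–Walsh
coefficients in the face bits are staggered joint-pivotality cumulants of ONE homogeneous critical
model, the second one being the
checkerboard structure factor S_R(π,π) of the series-minus-parallel PAIR KERNEL M_R(x) = Σ_v [P(v,
v+x pivotal in series) − P(in
parallel)] (WalshPairIdentity). SymmetricPointFlatness is the conjunction of three statements about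
g: SecondOrderNode (g''(1/2) → 0:
bond-ℤ² = the checkerboard planting sits on the nodal line of a d-wave form factor), EvenTail (g(1)
+ g(0) − 2g(1/2) − g''(1/2)/4 → 0:
the even levels ≥ 4), OddShift (g(1) − g(0) → 0: the two bond encodings, a half-diagonal lattice
shift apart, cross alike). Exact
algebra gives g(0) = g(1/2) + (EvenTail-term + g''/4 − OddShift-term)/2, so X contains
MixedInterpolation of route UnionJackBeffara
(stmt-CriticalPhenomena-4559) and, with Cardy for site percolation on G_s (UnionJackCardy, reached
through the shared items
UnionJackMorera → UnionJackEndgame) and the shared CoveringBridge, gives CardyFormulaZ2. The ENGINE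
behind SecondOrderNode is the
card's Conjecture K, filed pointwise as the rank-2 crux PairKernelDWave: M_R^δ(x) converges for
every offset x ≠ 0 to a finite
m_R(x) with m_R(Rx) = −m_R(x) (R the quarter turn), although each of its two terms sums to ≍
δ^(-3/4).
Lean: `let Z : Literature.Barriers.CriticalPhenomena.MixedSite → ℂ := fun v => Sum.elim (fun x : ℤ ×
ℤ => (((x.1 + x.2 : ℤ) : ℂ) + ((x.2 - x.1 + 1 : ℤ) : ℂ) * Complex.I) / 2) (fun f : ℤ × ℤ => (((f.1 +
f.2 + 1 : ℤ) : ℂ) + ((f.2 + 1 - f.1 : ℤ) : ℂ) * Complex.I) / 2) v; let G : SimpleGraph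
Literature.Barriers.CriticalPhenomena.MixedSite := SimpleGraph.fromRel fun u v => ∃ x : ℤ × ℤ, u =
Sum.inl x ∧ (v = Sum.inl (x.1 + 1, x.2) ∨ v = Sum.inl (x.1, x.2 + 1) ∨ ∃ f : ℤ × ℤ, v = Sum.inr f ∧
(x.1 = f.1 ∨ x.1 = f.1 + 1) ∧ (x.2 = f.2 ∨ x.2 = f.2 + 1)); let P : unitInterval →
Literature.Probability.RandomPlanarGeometry.ConformalRectangle → ℝ → ℝ := fun q R δ =>
(Literature.Probability.LatticeModels.prodBernoulli
(Literature.Barriers.CriticalPhenomena.mixedParam q)).real {ω | ∃ u v, Metric.infDist ((δ : ℂ) * Z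
u) (R.arc 0) ≤ 2 * δ ∧ Metric.infDist ((δ : ℂ) * Z v) (R.arc 2) ≤ 2 * δ ∧ ω ∈
Literature.Probability.Percolation.siteConnIn G {y | (δ : ℂ) * Z y ∈ R.carrier} u v}; (∀ R :
Literature.Probability.RandomPlanarGeometry.ConformalRectangle, Tendsto (fun δ : ℝ => iteratedDeriv
2 (fun t : ℝ => P (Set.projIcc (0 : ℝ) 1 zero_le_one t) R δ) (1 / 2)) (𝓝[>] 0) (𝓝 0)) ∧ (∀ R :
Literature.Probability.RandomPlanarGeometry.ConformalRectangle, Tendsto (fun δ : ℝ => P 1 R δ + P 0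
R δ - 2 * P Literature.Probability.Percolation.half R δ - (1 / 4) * iteratedDeriv 2 (fun t : ℝ => P
(Set.projIcc (0 : ℝ) 1 zero_le_one t) R δ) (1 / 2)) (𝓝[>] 0) (𝓝 0)) ∧ (∀ R :
Literature.Probability.RandomPlanarGeometry.ConformalRectangle, Tendsto (fun δ : ℝ => P 1 R δ - P 0
R δ) (𝓝[>] 0) (𝓝 0)) ∧ ∀ R : Literature.Probability.RandomPlanarGeometry.ConformalRectangle,
R.HasCrossingLimit (P Literature.Probability.Percolation.half R)
Literature.Probability.RandomPlanarGeometry.cardyFunction`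

## Assembly
Tendsto bookkeeping, PROVED sorry-free in the planner's SketchProof.lean (`assembly_provable`): from
SecondOrderNode (C → 0), EvenTail
(A → 0) and OddShift (B → 0) the exact identity P_0 = P_(1/2) + (A + C/4 − B)/2 gives, for every R
and uniformizing datum,
Tendsto (P 0 R) (𝓝[>] 0) (𝓝 (F η)) once UnionJackEndgame applied to UnionJackMorera gives Tendsto (P
half R) → F η (Cardy on G_s);
CoveringBridge converts '∀ R, HasCrossingLimit (P 0 R) cardyFunction' into CardyFormulaZ2
(root-level conjunct constant). PairKernelDWave
and WalshPairIdentity are the engine and the dictionary of SecondOrderNode (its foreseen children),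
not antecedents of the Assembly.

Rationale: WHY THIS LINE. Beffara2008Universal §5 turns CardyFormulaZ2 ⟸ (Cardy on G_s) into the flatness of q
↦ P_(1/2,q)[U] and stalls on a two-model
comparison (Δ(v) under P_q vs P_(1−q): barrier CoveringLatticeShift); this line never leaves q =
1/2: g is a polynomial, its
expansion at the symmetric point is exact and finite (Fourier–Walsh in the face bits, the technology
of GarbanPeteSchramm2010 but
with SIGNED level-k coefficients paired against lattice characters ε_S, not squared weights), odd
levels are a unit-shift difference
of bond-ℤ² with itself (OddShift), and at level 2 the divergent monopole of the pair kernel cancels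
identically in the offset x
because the unlabelled alternating 4-arm incipient cluster (Kesten1986 on G_s; ratio limits
GarbanPeteSchramm2013Pivotal §5) is
colour-flip invariant while the flip exchanges 'series' and 'parallel' — what survives is the
coupling of the directed pair to the
far-field label quadrupole, the spin-2 channel of rate exactly 2 − 5/4 = 3/4 (Coulomb gas and
conformal perturbation theory, Cardy1996), a FINITE d-wave
kernel whose (π,π) structure factor must vanish by Z4 while stripe plantings read off the LPPS/DKKMO
shear (doi:10.1007/bf01049720,
DKKMO2020Rotational). Imported areas: Boolean Fourier analysis / noise sensitivity (level-k Walsh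
coefficients of crossing events),
near-critical IIC technology (ratio limits, pivotal measures), lattice angular-momentum selection
rules of conformal field theory
(as a classification of the remainder kernel, tested by exact transfer matrices: S(π,π) = .0359 →
.0239 for W = 7 → 13, diagonal
nodes and S(Rk) = −S(k) to 1e−11 on squares). What no open route does: UnionJackBeffara (leg II) and
CardySectorGap integrate a
one-site rate over q ∈ [0, 1/2] (two measures); CardyFlipRusso deforms triangulations through a
Voronoi hub; CardyWhiteToColoured's
series-minus-parallel drift lives on ℤ² edges along a noise heat flow with a square sum rule; here
the object is a same-measure pair
kernel at q = 1/2 with an exact pointwise monopole cancellation and a momentum law, and the first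
typed second-order statement on
Beffara's family. Negatives index (stmt-CriticalPhenomena-0772, SAW) is untouched.

RANKED CRUXES. #0 Target (target) — X = (SecondOrderNode ∧ EvenTail ∧ OddShift) ∧ UnionJackCardy:
the three symmetric-point flatness statements for the crude mixed crossing probability of every
conformal rectangle on δG_s, and Cardy's formula for critical site percolation on G_s (crude
discretisation, P_(1/2,1/2)); all four conjuncts inlined over UnionJackBeffara's `let Z G P`. (why
it might fail: UnionJackCardy is as open as the target; flatness dies if the R-even part of the pair
kernel has an O(1) alternating sum (no node), if the even Walsh tail converges only after
inter-level cancellation, or on rough Jordan boundaries where the crude 2δ-arc rule is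
shift-sensitive.) [Beffara2008Universal, GarbanPeteSchramm2010, GarbanPeteSchramm2013Pivotal,
Kesten1986, doi:10.1007/bf01049720, Smirnov2001]
#2 PairKernelDWave (crux) — ENGINE (card Conjecture K, pointwise form). For every conformal
rectangle R and every face offset x ≠ 0, the Walsh pair kernel M_R^δ(x) = Σ_(v ∈ ℤ²) κ_R^δ(v, v +
x), κ_R^δ(v, w) = E_(1/2)[1_U σ_v σ_w] = (1/4)[P(v, w pivotal in series for U) − P(in parallel)] (U
= crude crossing of R at mesh δ on G_s, σ_f = ±1 the colour of face centre inr f, P_(1/2,1/2) =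
critical site percolation on G_s; finitely supported sum), converges as δ → 0⁺ to a FINITE limit
m_R(x), and m_R(Rx) = −m_R(x) for the quarter turn R x = (−x₂, x₁) (pure spin 2: no s-wave, no
spin-4k part), although Σ_v P(series) alone is ≍ δ^(−3/4). [difficulty: open-problem] (why it might
fail: a colour-odd rotation-scalar 4-arm correction of rate ≤ 3/4 (c = 0 log-CFT surprise) makes
M^δ(x) diverge or leaves an R-even limit; boundary-layer pairs (40% of c₂ at W ≤ 13) may add an O(1)
s-wave part; in print only SOME coupling rate > 0 exists (GPS §5).) [Beffara2008Universal,
Kesten1986, GarbanPeteSchramm2013Pivotal, GarbanPeteSchramm2010, Cardy1996, doi:10.1007/bf01049720,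
DKKMO2020Rotational]
#3 SecondOrderNode (crux) — THE NODE (card (C) at momentum (π,π)). For every conformal rectangle R,
the second q-derivative at q = 1/2 of the crude mixed crossing probability g(q) = P_(1/2,q)[U_R^δ]
tends to 0 as δ → 0⁺. By WalshPairIdentity g''(1/2) = 4 Σ_(v≠w) ε_v ε_w κ_R^δ(v,w) = 4 Σ_(x≠0)
(−1)^(x₁+x₂) M_R^δ(x) = S_R(π,π), the checkerboard structure factor of the pair kernel; the R-odd
part of M^δ drops out of this alternating sum exactly, so the content is: the (π,π) structure factor
of the R-EVEN part of the finite-δ kernel vanishes in the limit. [deps: PairKernelDWave]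
[difficulty: XL] (why it might fail: S_R(π,π) = .0359 → .0239 (W = 7 → 13, effective exponent .46 →
.72) could plateau: the node needs the R-even part to die inside an alternating sum of δ^(−2) terms,
not just pointwise, and the marginal rate exactly 3/4 may leave 1/log δ or nothing.)
[Beffara2008Universal, GarbanPeteSchramm2010, GarbanPeteSchramm2013Pivotal,
KohlerSchindlerTassion2023, doi:10.1007/bf01049720]
#4 EvenTail (crux) — HIGHER EVEN LEVELS (card K2). For every conformal rectangle R, g(1) + g(0) − 2
g(1/2) − g''(1/2)/4 → 0 as δ → 0⁺, i.e. 2 Σ_(k even ≥ 4) g^(k)(1/2)/(k! 2^k) → 0: the staggered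
joint-pivotality cumulants of 4, 6, … face centres (each with the same flip sign (−1)^(|S|+1), hence
each an R-odd kernel paired with an R-even character) sum to o(1) with control uniform in the level
up to h = ±1/2. [deps: SecondOrderNode] [difficulty: XL] (why it might fail: at W ≤ 13 level 4 is
flat (≈ 6e-3) and levels 6, 8 still grow; every even level is marginal (rate exactly 3/4 per
insertion) and there are up to δ^(−2) levels, so the tail may converge only through cancellation
BETWEEN levels, or not at all.) [Beffara2008Universal, GarbanPeteSchramm2010, SchrammSteif2010,
KohlerSchindlerTassion2023]
#5 UnionJackMorera (crux) — SHARED leg (I) = item UnionJackMorera of route UnionJackBeffara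
(stmt-CriticalPhenomena-4558), restated verbatim so the ledger attaches this route: for every
conformal rectangle with a Carleson datum there are two Smirnov separating families (tree
IsSmirnovFamily) sandwiching the crude P_(1/2,1/2) site-crossing probability of R on δG_s — the G_s
analogue of the proved triangular fact smirnov_exists_separatingFamilies; with UnionJackEndgame it
yields Cardy on G_s (card K3). This route does not attack it. [difficulty: open-problem] (why it
might fail: ψ(e) ≠ 0 on the 4.8.8 dual, so Σψ(e)P_A(e) ≍ δ^(−1/3) before cancellation; the contour
relation (36) for subsequential limits needs Beffara's level-one expansion AND β ≠ 2i (route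
UnionJackBeffara); Cardy on G_s is as open as the target.) [Beffara2008Universal, Beffara2007,
BollobasRiordan2006, Smirnov2009CriticalPercolation, Kesten1986, GarbanPeteSchramm2013]
#6 CoveringBridge (crux) — SHARED = item CoveringBridge of route UnionJackBeffara
(stmt-CriticalPhenomena-4560), verbatim: if the crude P_(1/2,0) crossing probability on δG_s
converges to Cardy's F(η) for every conformal rectangle, then G02's bondDomainCrossingProb R δ
(bond-ℤ² at 1/2, largest component, discrete arcs) converges to F(η) for every R (Kesten covering
dictionary at fixed δ + Bollobás–Riordan Lemma-14 sandwich + continuity of F∘η). [difficulty: L]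
(why it might fail: crude events check vertices not edges (G_s paths need edge midpoints in Ω, bond
paths may jump thin fjords); for fat Jordan boundaries 'largest component = bulk' is unproved in
tree, so the sandwich must use smooth approximants and continuity of F.) [KestenPTM1982,
Beffara2008Universal, BollobasRiordan2006, Grimmett2018, stmt-CriticalPhenomena-0787]
#7 OddShift (crux) — ODD LEVELS = bond-ℤ² against its own translate (card S2, Beffara's eq. (almost)
summed): for every conformal rectangle R, P_(1/2,1)[U_R^δ] − P_(1/2,0)[U_R^δ] → 0 as δ → 0⁺. Under q
= 1 the open G_s clusters through type-I sites are the open DUAL-lattice bond clusters, i.e. bond-ℤ²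
translated by half a diagonal mesh (odd translation, tree mixedPi_map_mixedTranslate_of_odd), so
this is insensitivity of crude bond-ℤ² crossing probabilities to an O(δ) shift of the lattice
relative to Ω; it equals 2 Σ_(k odd) g^(k)(1/2)/(k! 2^k), all odd Walsh levels at once. [difficulty:
L] (why it might fail: for smooth R it is RSW + boundary 3-arm counting (Beffara: 'RSW estimates are
actually enough'), but for rough Jordan boundaries / marks at prime ends the crude 2δ-arc rule is
lattice-position sensitive — the same hazard as CoveringBridge, met one item earlier.)
[Beffara2008Universal, KestenPTM1982, Nolin2008, BollobasRiordan2006, KohlerSchindlerTassion2023]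
#9 UnionJackEndgame (support) — SHARED = item UnionJackEndgame of route UnionJackBeffara
(stmt-CriticalPhenomena-4561), verbatim: UnionJackMorera → Cardy's formula for the crude P_(1/2,1/2)
site crossing of every conformal rectangle on δG_s (copy of the tree's
smirnov_tendsto_triDomainCrossingProb_of_limitArgument +
hasCrossingLimit_triDomainCrossingProb_of_carleson with the proved facts
triangleIntegral_eq_zero_of_forall_lattice_holds, smirnov_claim24_holds, exists_isCarlesonMap_holds,
cardyFunction_crossRatio_eq_carlesonRatio_holds). [difficulty: provable-now] [BollobasRiordan2006,
Smirnov2001, Beffara2007]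
#9 WalshPairIdentity (support) — (E1) at level 2, the dictionary between the chain and the kernel:
for every R and δ > 0, g''(1/2) = 4 Σ_((v,w), v ≠ w) ε_v ε_w κ_R^δ(v, w) with ε_f = +1 on type II
(f₁+f₂ even), −1 on type III, κ as in PairKernelDWave (finitely supported: faces outside Ω have
mean-zero colour independent of U). Proof: U depends on the finitely many sites mapped into Ω; on
that marginal dP_(1/2,1/2+h)/dP_(1/2,1/2) = Π_f (1 + 2hε_f σ_f), so g(1/2 + h) = Σ_S (2h)^|S| ε_S
E_(1/2)[1_U σ_S] (site-inhomogeneous Russo/Walsh over prodBernoulli (mixedParam q); tree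
RussoFormula.lean, SiteRusso.lean for the homogeneous case). [difficulty: M] [Beffara2008Universal,
GarbanPeteSchramm2010, Grimmett1999]

TWO-LAYER PLAN. Foreseen glued splits (k ≤ 3, depth 1; nothing filed now). SecondOrderNode ⇐
PairKernelDWave → EvenPartNode → SecondOrderNode, glue =
WalshPairIdentity + 'the R-odd part of a finitely supported kernel has zero (π,π) structure factor'
(exact reindexing), where EvenPartNode
says Σ_(x≠0) (−1)^(x₁+x₂) [M^δ(x) + M^δ(Rx)] → 0 (the alternating sum of the R-even part; small
offsets die pointwise by PairKernelDWave,
large offsets by smoothness in x against the zone-corner character). PairKernelDWave ⇐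
MonopoleCancellation (exact: in the unlabelled
alternating 4-arm IIC of G_s, P(series at offset x) = P(parallel at offset x) for every x, from flip
invariance of the IIC and
'parallel for open = series for closed'; needs Kesten's IIC / GPS ratio limits on G_s, RSW via
KohlerSchindlerTassion2023) →
QuadrupoleCouplingRate (the labelled far field couples to the local pair law at relative order
(|x|δ)^(3/4) with a cos 2φ profile and
all other channels at rate > 3/4; boundary-collar pairs contribute o(1)) → PairKernelDWave. EvenTail
⇐ LevelwiseNodes (each even level
2k → 0, same mechanism with 2k-face kernels) → UniformLevelControl (summable in k up to |h| = 1/2,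
e.g. via hypercontractive /
spectral-sample tail bounds à la GarbanPeteSchramm2010, SchrammSteif2010) → EvenTail. OddShift ⇐
SmoothDomains (RSW + boundary 3-arm) →
RoughBoundaryApproximation (inner/outer smooth conformal rectangles + continuity, shared in content
with CoveringBridge's foreseen
ZdLemma14) → OddShift. UnionJackMorera and CoveringBridge split as foreseen in route
UnionJackBeffara, not here.

KILL CRITERIA. ¬SecondOrderNode — S_R(π,π) bounded below for one rectangle (exact TM at W = 14–16 or
variance-reduced Monte Carlo of Σ ε_vε_w(1_ser −
1_par) at W = 32–128 showing a plateau, or a proof that the R-even part has an O(1) alternating sum)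
— refutes the thesis outright: close
`refuted:SecondOrderNode` (the d-wave node IS the line; record the plateau value as the second-order
universality defect of bond-ℤ² —
sensational either way, since MixedInterpolation would then need inter-level cancellation).
¬PairKernelDWave with SecondOrderNode alive
(kernel log-divergent in the spin-2 channel, or an O(1) s-wave boundary part whose alternating sum
still vanishes) forces a pivot, not
a close: restate the engine as EvenPartNode (Two-layer plan) by `--restate PairKernelDWave`.
¬EvenTail (levels ≥ 4 carry O(1) in
total) kills the level-by-level thesis: close `refuted:EvenTail` unless the refutation exhibits the
inter-level cancellation, in which
case pivot to a resummed statement (sup over q ∈ [0,1] of |g(q) − g(1/2)| via a cluster expansion in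
h with uniform RSW) as a NEW route.
¬OddShift would mean the two Kesten encodings of bond-ℤ² have different crude crossing limits —
statement hygiene of the crude
discretisation (report to operator; the same clause as UnionJackBeffara's CoveringBridge), route
blocked not dead. ¬UnionJackMorera /
¬CoveringBridge: as in route UnionJackBeffara (shared items; β = 2i kills leg I as a PROOF only).
CardyFormulaZ2 or MixedInterpolation
(stmt-CriticalPhenomena-4559) proved elsewhere moots the chain; PairKernelDWave and SecondOrderNode
keep independent value (first
quantitative universality statement on Beffara's family; the off-node values are the LPPS shear
κ_R(k) of every periodic planting).

NOT DECOMPOSED YET. The exact finite identities (E2): P_(1/2)(ser_abcd(v,w)) =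
P_(1/2)(par_bcda(v,w)), g_abcd(q) + g_bcda(1 − q) = 1, exact R-oddness of
M for the odd square and evenness of g for boxes with an odd side — helper lemmas riding with
`--supports WalshPairIdentity` /
`--supports PairKernelDWave` (they need the label-rotated rectangle bcda as a ConformalRectangle, a
construction, not an item). The IIC
on G_s, ratio limits and the coupling rate (children of PairKernelDWave); EvenPartNode (child of
SecondOrderNode); levelwise statements
and the uniform level control (children of EvenTail); smooth-domain OddShift and the rough-boundary
approximation (children of OddShift).
The off-node predictions — diagonal nodes S_R(k₁, ±k₁) = 0 for axis-symmetric R, antisymmetry S(Rk)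
= −S(k), |k|^(−3/2) cos 2φ_k small-k
law, the stripe shear κ — are FALSIFIERS of PairKernelDWave, not items. Interval-arithmetic
certification of the W ≤ 13 tables is kit
evidence to attach to SecondOrderNode, not an item. No third layer will be filed.

CHEAPEST FALSIFIER. Extend the card's exact transfer matrix (tm/gs_tm.c in the mechhunt planner's
folder: boxes W × (2W − 1), crossing the short way,
validated against brute force and exact rationals; ≈ 0.5–4 h and ≤ 12 GB per width) to W = 14, 15,
16 and re-read three monotone trends:
S(π,π) = g''(1/2) (.0359, .0309, .0270, .0254, .0239 for W = 7, 9, 11, 12, 13), S(π/2,π/2) (.0171,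
.0133, .0115) and the s-wave leak
S(π,0) + S(0,π) (−.048, −.040, −.035). A plateau of the first kills SecondOrderNode (and the route),
of the third kills the spin-2 purity
half of PairKernelDWave; growth of D_cb = P_bond − P_site (3.34e-3 at W = 13, falling ~W^(−0.7))
kills MixedInterpolation for everyone.
Not run here (plancard seat: no kit in payload, TM source not in this folder). Lookup done
(Novelty): no second-order / pair-kernel
computation on Beffara's family exists in print.

NUMBERS. Exponents (𝕋 values, SmirnovWerner2001; universality assumed on G_s): 4-arm 5/4, so Σ_v P(v
pivotal) ≍ δ^(−3/4) and each of Σ_v P(ser),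
Σ_v P(par) ≍ δ^(−3/4); spin-2 (stress tensor) dimension 2, coupling rate 2 − 5/4 = 3/4 exactly
marginal against the pivotal mass
(Beffara's heuristic Δ(v) ≈ δ^(9/4) vs δ² is the one-site version); predicted kernel tail m_R(x) ~
C_R |x|^(−1/2) cos 2(φ_x − φ_R) and
S_R(k) ∝ |k|^(−3/2) cos 2φ_k as k → 0. Card's exact TM data (double precision, W × (2W−1) boxes):
S(π,π) = .0359 (W=7), .0309 (9), .0270
(11), .0254 (12), .0239 (13); D_cb = P_bond − P_site(G_s) = 6.21e-3 (W=4) … 3.75e-3 (11), 3.54e-3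
(12), 3.34e-3 (13); stripes D_row =
.025 → .037 (O(1) limit ≈ .04, a sheared planting); S(π,0)/S(0,π) = −.320/+.272 (7), −.333/+.293
(9), −.341/+.307 (11); odd square:
S(k) = −S(Rk) and diagonal zeros to 1e−11 (exact, (E2)); local Z4 2×2 patch c₂ ~ W^(−3.80±.02).
Square crossing of G_s-site and of every
P_(1/2,q) on a type-I-centred odd square is exactly 1/2 (all Walsh levels vanish by RotI: ε_RS =
(−1)^|S| ε_S). Items at open: 10
(target, 6 cruxes of which 2 shared, 2 supports of which 1 shared, assembly).

DEFINITION REQUESTS. None new. Route UnionJackBeffara's pending requests (unionJackGraph,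
unionJackEmbed, ujCrossingProb in Literature/Probability/Percolation)
would let every decl here drop the `let Z G P` blob; when they land, a `ujWalshCoeff R δ S`
(E_(1/2)[1_U σ_S]) and `ujPairKernel R δ x`
would shorten PairKernelDWave / WalshPairIdentity the same way — to be requested by the tenure
planner then, not now.

Novelty: Searches (2026-08-15, this seat): `lit frontier CriticalPhenomena --since 2021` (30 rows; none on
Beffara's family, mixed percolation,
second-order universality defects or pair kernels); `lit bridges CriticalPhenomena --cross any` (30
rows, none relevant); `lit galaxy
search --star all` on "centered square lattice" (17 rows, solid-state only), "mixed percolation"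
(14: Kesten PTM, Bollobás–Riordan,
mixed site-bond DIRECTED percolation J.Phys.A 1995 — thresholds, other object), "universality of
crossing probabilities" (12:
Pruessner–Moloney cond-mat/0309126, Simmons–Kleban–Ziff arXiv:1103.5691, Maier math-ph/0210013,
Langlands–Lewis–Saint-Aubin Ising),
"pivotal pair" (0 relevant); `lit search --source crossref` "Beffara … mixed percolation centered
square lattice" (11:
doi:10.1007/978-3-7643-8786-0_3 = Beffara2008Universal, Wierman 1984 doi:10.1017/s0021900200024657
mixed site-bond thresholds,
Beffara–Nolin doi:10.1214/10-aop581), "universality crossing probabilities … Langlands" (12: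
doi:10.1007/bf01049720,
doi:10.1090/s0273-0979-1994-00456-2, Tassion doi:10.1214/15-aop1052, Köhler-Schindler–Tassion
doi:10.1215/00127094-2022-0015, Yonezawa
et al. doi:10.1103/physrevb.40.650 'extent of universality'), "anisotropic bond percolation crossing
… effective aspect ratio" (12:
Grimmett–Manolescu doi:10.1214/11-aop740 and doi:10.1214/11-aop729, McGurn 1983); zbMATH "crossing
probability anisotropic percolation"
(2, unrelated); arXiv/S2/OpenAlex rate-limited (429) this session, as in th  [refs: 10.1007/978-3-7643-8786-0_3, 10.1017/s0021900200024657, 10.1214/10-aop581, 10.1007/bf01049720, 10.1090/s0273-0979-1994-00456-2, 10.1214/15-aop1052, 10.1215/00127094-2022-0015, 10.1103/physrevb.40.650, 10.1214/11-aop740, 10.1214/11-aop729, 1103.5691, 0708.3908, 0803.3750, 1008.1378, 2012.11672, doi:10.1007/978-3-7643-8786-0_3, doi:10.1017/s0021900200024657, doi:10.1214/10-aop581, doi:10.1007/bf0104]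

Barriers (technique_class: staggered-cumulants IIC-flip-cancellation structure-factor): - technique_class: staggered-cumulants IIC-flip-cancellation structure-factor
- Literature.Barriers.CriticalPhenomena.CoveringLatticeShift: evaded by construction — no identity
here pairs a type-II with a type-III site under P_(1/2,q), q ≠ 1/2: every cumulant lives at q = 1/2
where the flip IS a symmetry of the same measure (tree mixedPi_map_flip_eq_self_iff), the passage to
q ∈ {0, 1} is the exact finite Taylor/Walsh expansion of the polynomial g, and the only cross-q
comparison, OddShift, compares bond-ℤ² (q = 0) with its own odd translate (q = 1; conjunct (2) of
the Narrow form), never two different models; the barrier's 'rate statements … which no conjunct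
constrains' is where PairKernelDWave sits, openly, as ONE kernel property.
- Literature.Barriers.CriticalPhenomena.CoveringLatticeShiftNarrow: same evasion; of its residual
index-2 group the line uses the face-centred quarter turn (R-oddness of the kernel, the (π,π)
character being R-even), even translations (the kernel is summed over v) and flip∘odd-translation
(OddShift = bond self-duality read on G_s); nothing type-exchanging is used alone.
- Literature.Barriers.CriticalPhenomena.SmirnovTriangularOnly: applies verbatim to the shared leg
UnionJackMorera (ψ ≢ 0 on the 4.8.8 dual); not evaded here — the bet is route UnionJackBeffara's
(level-one expansion + β ≠ 2i), and any other proof of Cardy on G_s (CardyFlipRusso's Voronoi hub)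
substitutes.
- Literature.Barriers.CriticalPhenomena.EmbeddingModulusUniqueness: not trig

Novelty grade: new-combination — route-review gen-2 (refuter 81300ae8-g2) NOVELTY new-combination = [Beffara's interpolation q -> P_{1/2,q} on G_s (0708.3908 s5; = UnionJackBeffara's MixedInterpolation leg, stmt-4559)] x [Fourier–Walsh level decomposition of a crossing event in the face bits (GPS 0803.3750 technology) at the colour (refuter refuter-rreview-route-CriticalPhenomena--81300ae8-g2-0, 2026-08-15T14:59:01Z; prior: arXiv:0708.3908 Beffara2008Universal s5 (mixed family P_{1/2,q}, one-site Delta(v), eq. (almost)), arXiv:0803.3750 GarbanPeteSchramm2010 (Fourier-Walsh spectrum of crossing events), GarbanPeteSchramm2013Pivotal (pivotal measures, ratio limits), Kesten1986 (IIC), SchrammSteif2010, doi:10.1007/bf01049720 LPPS (universality/anisotropy of crossings), arXiv:2012.11672 DKKMO2020Rotational, KohlerSchindl)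

History (route lifecycle, newest last):
- 2026-08-16T03:40:55Z · rev 6: dropped TargetGlue — dedupe glue (re-issue after an empty gate response): the parallel repair seat's TargetFromCruxes (stmt-CriticalPhenomena-14457, rank 10) already concludes the T (planner-rchoice-CriticalPhenomena-DWavePairKer-d761f8f5-0)
- 2026-08-16T03:45:00Z · AUTO-CRUX (edit): Target — hypotheses of the deciding theorem that nothing in the route derives are cruxes (planner-rchoice-CriticalPhenomena-DWavePairKer-d761f8f5-0)
- 2026-08-16T16:41:46Z · AUTO-CRUX (backfill): Target — hypotheses of the deciding theorem that nothing in the route derives are cruxes (operator:999:1813213)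
- 2026-08-24T15:48:23Z · DORMANT — reconciler: no traction for 6.9 d (last activity item-evidence-added at 2026-08-17T18:15:54Z); parked, not closed — `ledger route dormant route-CriticalPhenomen (operator:999:1890538)

sub-problem: CardyFormulaZ2 · status: dormant · opened planner-plancard-CriticalPhenomena-CardyFormu-c63016aa-0 2026-08-15T12:43:53Z · rev 10 · ledger route-CriticalPhenomena-DWavePairKernel
GENERATED by the gate from the ledger (D-0016/17). Provers cite these decls: `theorem foo : Summit.CriticalPhenomena.CardyFormulaZ2.Theses.DWavePairKernel.<Decl> := …` in Summits/CriticalPhenomena/CardyFormulaZ2/Theorems/<Name>.lean.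
-/

namespace Summit.CriticalPhenomena.CardyFormulaZ2.Theses.DWavePairKernel

open scoped BigOperators Topology Manifold Classical MeasureTheory ProbabilityTheory Matrix InnerProductSpace ComplexConjugate ContinuousMap
open Filter Set Function TopologicalSpace MeasureTheory

attribute [summit_statement] _root_.CardyFormulaZ2

/-- item stmt-CriticalPhenomena-8372 · crux (kind.auto-crux: conjecture-grade) · rank 0 · open · by planner
why it might fail: Cardy on G_s is as open as CardyFormulaZ2, whose negation arXiv:2206.04599 claims (unrefereed; at odds with the LPS 1994 numerics); flatness dies if the R-even pair kernel keeps an O(1) alternating sum, if even levels ≥ 4 cancel only across levels, or if the crude 2δ-arc rule is shift-sensitive.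
sources: Beffara2008Universal, GarbanPeteSchramm2010, GarbanPeteSchramm2013Pivotal, Kesten1986, doi:10.1007/bf01049720, Smirnov2001
[target] X = (SecondOrderNode ∧ EvenTail ∧ OddShift) ∧ UnionJackCardy: the three symmetric-point
flatness statements for the crude mixed crossing probability of every conformal rectangle on δG_s,
and Cardy's formula for critical site percolation on G_s (crude discretisation, P_(1/2,1/2)); all
four conjuncts inlined over UnionJackBeffara's `let Z G P`. -/
@[route_item "route-CriticalPhenomena-DWavePairKernel", crux]
def Target : Prop :=
  let Z : Literature.Barriers.CriticalPhenomena.MixedSite → ℂ := fun v => Sum.elim (fun x : ℤ × ℤ => (((x.1 + x.2 : ℤ) : ℂ) + ((x.2 - x.1 + 1 : ℤ) : ℂ) * Complex.I) / 2) (fun f : ℤ × ℤ => (((f.1 + f.2 + 1 : ℤ) : ℂ) + ((f.2 + 1 - f.1 : ℤ) : ℂ) * Complex.I) / 2) v; let G : SimpleGraph Literature.Barriers.CriticalPhenomena.MixedSite := SimpleGraph.fromRel fun u v => ∃ x : ℤ × ℤ, u = Sum.inl x ∧ (v = Sum.inl (x.1 + 1, x.2) ∨ v = Sum.inl (x.1,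 x.2 + 1) ∨ ∃ f : ℤ × ℤ, v = Sum.inr f ∧ (x.1 = f.1 ∨ x.1 = f.1 + 1) ∧ (x.2 = f.2 ∨ x.2 = f.2 + 1)); let P : unitInterval → Literature.Probability.RandomPlanarGeometry.ConformalRectangle → ℝ → ℝ := fun q R δ => (Literature.Probability.LatticeModels.prodBernoulli (Literature.Barriers.CriticalPhenomena.mixedParam q)).real {ω | ∃ u v, Metric.infDist ((δ : ℂ) * Z u) (R.arc 0) ≤ 2 * δ ∧ Metric.infDist ((δ : ℂ) * Z v) (R.arc 2) ≤ 2 * δ ∧ ω ∈ Literature.Probability.Percolation.siteConnIn G {y | (δ : ℂ) * Z y ∈ R.carrier} u v}; (∀ R : Literature.Probability.RandomPlanarGeometry.ConformalRectangle, Tendsto (fun δ : ℝ => iteratedDeriv 2 (fun t : ℝ => P (Set.projIcc (0 : ℝ) 1 zero_le_one t) R δ) (1 / 2)) (𝓝[>] 0) (𝓝 0)) ∧ (∀ R : Literature.Probability.RandomPlanarGeometry.ConformalRectangle, Tendsto (fun δ : ℝ => P 1 R δ + P 0 R δ - 2 * P Literature.Probability.Percolation.half R δ - (1 / 4) * iteratedDeriv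 2 (fun t : ℝ => P (Set.projIcc (0 : ℝ) 1 zero_le_one t) R δ) (1 / 2)) (𝓝[>] 0) (𝓝 0)) ∧ (∀ R : Literature.Probability.RandomPlanarGeometry.ConformalRectangle, Tendsto (fun δ : ℝ => P 1 R δ - P 0 R δ) (𝓝[>] 0) (𝓝 0)) ∧ ∀ R : Literature.Probability.RandomPlanarGeometry.ConformalRectangle, R.HasCrossingLimit (P Literature.Probability.Percolation.half R) Literature.Probability.RandomPlanarGeometry.cardyFunction

/-- item stmt-CriticalPhenomena-8373 · crux · rank 2 · open · by planner
why it might fail: The far-field label coupling to a lattice pair is exactly marginal (rate 2 − 5/4 = 3/4): a log partner in the four-arm fusion channel (logs do occur at c = 0: arXiv:2407.04246 Thm 1.1, on 𝕋) makes Σ_v diverge like log(1/δ); boundary-collar pairs (40% of c₂ at W ≤ 13) may leave an O(1) s-wave part.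
sources: Beffara2008Universal, Kesten1986, GarbanPeteSchramm2013Pivotal, GarbanPeteSchramm2010, Cardy1996, doi:10.1007/bf01049720
[crux] ENGINE (card Conjecture K, pointwise form). For every conformal rectangle R and every face
offset x ≠ 0, the Walsh pair kernel M_R^δ(x) = Σ_(v ∈ ℤ²) κ_R^δ(v, v + x), κ_R^δ(v, w) = E_(1/2)[1_U
σ_v σ_w] = (1/4)[P(v, w pivotal in series for U) − P(in parallel)] (U = crude crossing of R at mesh
δ on G_s, σ_f = ±1 the colour of face centre inr f, P_(1/2,1/2) = critical site percolation on G_s;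
finitely supported sum), converges as δ → 0⁺ to a FINITE limit m_R(x), and m_R(Rx) = −m_R(x) for the
quarter turn R x = (−x₂, x₁) (pure spin 2: no s-wave, no spin-4k part), although Σ_v P(series) alone
is ≍ δ^(−3/4). [difficulty: open-problem] -/
@[route_item "route-CriticalPhenomena-DWavePairKernel", crux]
def PairKernelDWave : Prop :=
  let Z : Literature.Barriers.CriticalPhenomena.MixedSite → ℂ := fun v => Sum.elim (fun x : ℤ × ℤ => (((x.1 + x.2 : ℤ) : ℂ) + ((x.2 - x.1 + 1 : ℤ) : ℂ) * Complex.I) / 2) (fun f : ℤ × ℤ => (((f.1 + f.2 + 1 : ℤ) : ℂ) + ((f.2 + 1 - f.1 : ℤ) : ℂ) * Complex.I) / 2) v; let G : SimpleGraph Literature.Barriers.CriticalPhenomena.MixedSite := SimpleGraph.fromRel fun u v => ∃ x : ℤ × ℤ, u = Sum.inl x ∧ (v = Sum.inl (x.1 + 1, x.2) ∨ v = Sum.inl (x.1, x.2 + 1) ∨ ∃ f : ℤ × ℤ, v = Sum.inr f ∧ (x.1 = f.1 ∨ x.1 = f.1 + 1) ∧ (x.2 = f.2 ∨ x.2 = f.2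 + 1)); let κ : Literature.Probability.RandomPlanarGeometry.ConformalRectangle → ℝ → ℤ × ℤ → ℤ × ℤ → ℝ := fun R δ v w => ∫ ω, Set.indicator {ω | ∃ u v, Metric.infDist ((δ : ℂ) * Z u) (R.arc 0) ≤ 2 * δ ∧ Metric.infDist ((δ : ℂ) * Z v) (R.arc 2) ≤ 2 * δ ∧ ω ∈ Literature.Probability.Percolation.siteConnIn G {y | (δ : ℂ) * Z y ∈ R.carrier} u v} (fun _ => (1 : ℝ)) ω * ((if Sum.inr v ∈ ω then (1 : ℝ) else -1) * (if Sum.inr w ∈ ω then (1 : ℝ) else -1)) ∂(Literature.Probability.LatticeModels.prodBernoulli (Literature.Barriers.CriticalPhenomena.mixedParam Literature.Probability.Percolation.half)); ∀ (R : Literature.Probability.RandomPlanarGeometry.ConformalRectangle) (x : ℤ × ℤ), x ≠ 0 → ∃ m : ℝ, Tendsto (fun δ : ℝ => ∑' v : ℤ × ℤ, κ R δ v (v + x)) (𝓝[>] 0) (𝓝 m) ∧ Tendsto (fun δ : ℝ => ∑' v : ℤ × ℤ, κ R δ v (v + (-x.2, x.1))) (𝓝[>] 0) (𝓝 (-m)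)

/-- item stmt-CriticalPhenomena-8374 · crux · rank 3 · open · by planner
why it might fail: S_R(π,π) = .0359 → .0239 for W = 7 → 13 (effective exponent .46 → .72) may plateau: the R-even part must die inside an alternating sum of ≍ δ^(−2) terms, not pointwise, and at the marginal rate 3/4 a log factor (cf. arXiv:2407.04246 Thm 1.1) leaves a 1/log(1/δ) tail or an O(1) defect.
sources: Beffara2008Universal, GarbanPeteSchramm2010, GarbanPeteSchramm2013Pivotal, KohlerSchindlerTassion2023, doi:10.1007/bf01049720, arXiv:2407.04246
[crux] THE NODE (card (C) at momentum (π,π)). For every conformal rectangle R, the second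
q-derivative at q = 1/2 of the crude mixed crossing probability g(q) = P_(1/2,q)[U_R^δ] tends to 0
as δ → 0⁺. By WalshPairIdentity g''(1/2) = 4 Σ_(v≠w) ε_v ε_w κ_R^δ(v,w) = 4 Σ_(x≠0) (−1)^(x₁+x₂)
M_R^δ(x) = S_R(π,π), the checkerboard structure factor of the pair kernel; the R-odd part of M^δ
drops out of this alternating sum exactly, so the content is: the (π,π) structure factor of the
R-EVEN part of the finite-δ kernel vanishes in the limit. [deps: PairKernelDWave] [difficulty: XL] -/
@[route_item "route-CriticalPhenomena-DWavePairKernel", crux]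
def SecondOrderNode : Prop :=
  let Z : Literature.Barriers.CriticalPhenomena.MixedSite → ℂ := fun v => Sum.elim (fun x : ℤ × ℤ => (((x.1 + x.2 : ℤ) : ℂ) + ((x.2 - x.1 + 1 : ℤ) : ℂ) * Complex.I) / 2) (fun f : ℤ × ℤ => (((f.1 + f.2 + 1 : ℤ) : ℂ) + ((f.2 + 1 - f.1 : ℤ) : ℂ) * Complex.I) / 2) v; let G : SimpleGraph Literature.Barriers.CriticalPhenomena.MixedSite := SimpleGraph.fromRel fun u v => ∃ x : ℤ × ℤ, u = Sum.inl x ∧ (v = Sum.inl (x.1 + 1, x.2) ∨ v = Sum.inl (x.1, x.2 + 1) ∨ ∃ f : ℤ × ℤ, v = Sum.inr f ∧ (x.1 = f.1 ∨ x.1 = f.1 + 1) ∧ (x.2 = f.2 ∨ x.2 = f.2 + 1)); let P : unitInterval → Literature.Probability.RandomPlanarGeometry.ConformalRectangle → ℝ → ℝ := fun q R δ => (Literature.Probability.LatticeModels.prodBernoulli (Literature.Barriers.CriticalPhenomena.mixedParam q)).real {ω | ∃ u v, Metric.infDist ((δ : ℂ) * Z u) (R.arc 0) ≤ 2 * δ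 ∧ Metric.infDist ((δ : ℂ) * Z v) (R.arc 2) ≤ 2 * δ ∧ ω ∈ Literature.Probability.Percolation.siteConnIn G {y | (δ : ℂ) * Z y ∈ R.carrier} u v}; ∀ R : Literature.Probability.RandomPlanarGeometry.ConformalRectangle, Tendsto (fun δ : ℝ => iteratedDeriv 2 (fun t : ℝ => P (Set.projIcc (0 : ℝ) 1 zero_le_one t) R δ) (1 / 2)) (𝓝[>] 0) (𝓝 0)

/-- item stmt-CriticalPhenomena-8375 · crux · rank 4 · open · by planner
why it might fail: No small parameter: at h = ±1/2 the weights (2h)^|S| = ±1, so all even levels ≥ 4 enter at full strength; at W ≤ 13 level 4 is flat (≈ 6e-3) while levels 6, 8 still grow; each insertion is marginal (rate 3/4) and there are ≍ δ^(−2) levels: convergence may need inter-level cancellation, or fail.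
sources: Beffara2008Universal, GarbanPeteSchramm2010, SchrammSteif2010, KohlerSchindlerTassion2023
[crux] HIGHER EVEN LEVELS (card K2). For every conformal rectangle R, g(1) + g(0) − 2 g(1/2) −
g''(1/2)/4 → 0 as δ → 0⁺, i.e. 2 Σ_(k even ≥ 4) g^(k)(1/2)/(k! 2^k) → 0: the staggered
joint-pivotality cumulants of 4, 6, … face centres (each with the same flip sign (−1)^(|S|+1), hence
each an R-odd kernel paired with an R-even character) sum to o(1) with control uniform in the level
up to h = ±1/2. [deps: SecondOrderNode] [difficulty: XL] -/
@[route_item "route-CriticalPhenomena-DWavePairKernel", crux]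
def EvenTail : Prop :=
  let Z : Literature.Barriers.CriticalPhenomena.MixedSite → ℂ := fun v => Sum.elim (fun x : ℤ × ℤ => (((x.1 + x.2 : ℤ) : ℂ) + ((x.2 - x.1 + 1 : ℤ) : ℂ) * Complex.I) / 2) (fun f : ℤ × ℤ => (((f.1 + f.2 + 1 : ℤ) : ℂ) + ((f.2 + 1 - f.1 : ℤ) : ℂ) * Complex.I) / 2) v; let G : SimpleGraph Literature.Barriers.CriticalPhenomena.MixedSite := SimpleGraph.fromRel fun u v => ∃ x : ℤ × ℤ, u = Sum.inl x ∧ (v = Sum.inl (x.1 + 1, x.2) ∨ v = Sum.inl (x.1, x.2 + 1) ∨ ∃ f : ℤ × ℤ, v = Sum.inr f ∧ (x.1 = f.1 ∨ x.1 = f.1 + 1) ∧ (x.2 = f.2 ∨ x.2 = f.2 + 1)); let P : unitInterval → Literature.Probability.RandomPlanarGeometry.ConformalRectangle → ℝ → ℝ := fun q R δ => (Literature.Probability.LatticeModels.prodBernoulli (Literature.Barriers.CriticalPhenomena.mixedParam q)).real {ω | ∃ u v, Metric.infDist ((δ : ℂ) * Z u) (R.arc 0) ≤ 2 * δ ∧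 Metric.infDist ((δ : ℂ) * Z v) (R.arc 2) ≤ 2 * δ ∧ ω ∈ Literature.Probability.Percolation.siteConnIn G {y | (δ : ℂ) * Z y ∈ R.carrier} u v}; ∀ R : Literature.Probability.RandomPlanarGeometry.ConformalRectangle, Tendsto (fun δ : ℝ => P 1 R δ + P 0 R δ - 2 * P Literature.Probability.Percolation.half R δ - (1 / 4) * iteratedDeriv 2 (fun t : ℝ => P (Set.projIcc (0 : ℝ) 1 zero_le_one t) R δ) (1 / 2)) (𝓝[>] 0) (𝓝 0)

/-- item stmt-CriticalPhenomena-4558 · crux · rank 5 · open · by planner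
why it might fail: As typed ⇔ Cardy for critical site percolation on G_s (UJEquiv.lean): open as the target. The one printed engine, Smirnov's Morera sum, has ψ(e) ≠ 0 on the 4.8.8 faces (ujPsi_zero_one, SmirnovTriangularOnly): Σψ(e)P_A(e) ≍ δ^(−1/3) must cancel; a non-conformal subsequential limit (β = 2i) is open.
sources: Beffara2008Universal, Beffara2007, BollobasRiordan2006, Smirnov2009CriticalPercolation, Kesten1986, GarbanPeteSchramm2013
[crux] leg (I) deliverable (card K1+K2 folded into Smirnov's discrete half): for every conformal
rectangle R with a Carleson datum (abc equilateral, d ∈ (c,a), ψ : Ω → Δ with boundary values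
a,b,c,d at the marks) there are δ₀ > 0 and two Smirnov separating families gm, gp (tree structure
IsSmirnovFamily: continuous [0,1]-valued, uniformly equicontinuous, every subsequential uniform
limit satisfies the contour relation (36) on lattice-parallel equilateral triangles and the boundary
values (37)) sandwiching the crude P_{1/2,1/2} site-crossing probability of R on δG_s up to e(δ) → 0
at points zm, zp → d' — the exact G_s analogue of the PROVED triangular fact
smirnov_exists_separatingFamilies. The families are the (interpolated) G_s separating probabilities
H^δ_α of inner/outer approximating domains; (36) is where ψ ≠ 0 bites and where (SE) + β ≠ 2i + the
relabelling/quarter-turn covariances of (discr) are to be used. [difficulty: open-problem] -/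
@[route_item "route-CriticalPhenomena-DWavePairKernel", crux]
def UnionJackMorera : Prop :=
  let Z : Literature.Barriers.CriticalPhenomena.MixedSite → ℂ := fun v => Sum.elim (fun x : ℤ × ℤ => (((x.1 + x.2 : ℤ) : ℂ) + ((x.2 - x.1 + 1 : ℤ) : ℂ) * Complex.I) / 2) (fun f : ℤ × ℤ => (((f.1 + f.2 + 1 : ℤ) : ℂ) + ((f.2 + 1 - f.1 : ℤ) : ℂ) * Complex.I) / 2) v; let G : SimpleGraph Literature.Barriers.CriticalPhenomena.MixedSite := SimpleGraph.fromRel fun u v => ∃ x : ℤ × ℤ, u = Sum.inl x ∧ (v = Sum.inl (x.1 + 1, x.2) ∨ v = Sum.inl (x.1, x.2 + 1) ∨ ∃ f : ℤ × ℤ, v = Sum.inr f ∧ (x.1 = f.1 ∨ x.1 = f.1 + 1) ∧ (x.2 = f.2 ∨ x.2 = f.2 + 1)); let P : unitInterval → Literature.Probability.RandomPlanarGeometry.ConformalRectangle → ℝ → ℝ := fun q R δ => (Literature.Probability.LatticeModels.prodBernoulli (Literature.Barriers.CriticalPhenomena.mixedParam q)).real {ω | ∃ u v, Metric.infDist ((δ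 : ℂ) * Z u) (R.arc 0) ≤ 2 * δ ∧ Metric.infDist ((δ : ℂ) * Z v) (R.arc 2) ≤ 2 * δ ∧ ω ∈ Literature.Probability.Percolation.siteConnIn G {y | (δ : ℂ) * Z y ∈ R.carrier} u v}; ∀ (R : Literature.Probability.RandomPlanarGeometry.ConformalRectangle) (a b c d : ℂ) (ψ : Literature.Probability.RandomPlanarGeometry.ConformalEquiv R.carrier (Literature.Probability.Percolation.openTriangle a b c)), Literature.Probability.Percolation.IsEquilateral a b c → d ∈ openSegment ℝ c a → Literature.Probability.Percolation.IsCarlesonMap R a b c d ψ → ∃ δ₀ > (0 : ℝ), ∃ gm gp : ℝ → Fin 3 → ℂ → ℝ, Literature.Probability.Percolation.IsSmirnovFamily R a b c δ₀ gm ∧ Literature.Probability.Percolation.IsSmirnovFamily R a b c δ₀ gp ∧ ∃ (zm zp : ℝ → ℂ) (e : ℝ → ℝ), (∀ δ ∈ Set.Ioo 0 δ₀, zm δ ∈ R.carrier ∧ zp δ ∈ R.carrier) ∧ Tendsto zm (𝓝[>] 0) (𝓝 (R.pt 3)) ∧ Tendsto zp (𝓝[>] 0) (𝓝 (R.pt 3))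 ∧ Tendsto e (𝓝[>] 0) (𝓝 0) ∧ ∀ δ ∈ Set.Ioo 0 δ₀, gm δ 1 (zm δ) - e δ ≤ P Literature.Probability.Percolation.half R δ ∧ P Literature.Probability.Percolation.half R δ ≤ gp δ 1 (zp δ) + e δ

/-- item stmt-CriticalPhenomena-4560 · support · rank 6 · closed · proved by Summit.CriticalPhenomena.CardyFormulaZ2.Theorems.coveringBridge_proof @ 511481cb7c86 (prover) · by planner
why it might fail: crude events check vertices not edges (G_s paths need edge midpoints in Ω, bond paths may jump thin fjords); for fat Jordan boundaries 'largest component = bulk' is unproved in tree, so the sandwich must use smooth approximants and continuity of F.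
sources: KestenPTM1982, BollobasRiordan2006, SchrammSmirnov2011, Beffara2008Universal, Literature.Probability.Percolation.QuadCrossing.SchrammSmirnov2011_lemma_6_1
[crux] Kesten's covering graph + discretisation robustness on ℤ²: if the crude P_{1/2,0} crossing
probability on δG_s converges to Cardy's F(η) for EVERY conformal rectangle, then G02's
bondDomainCrossingProb R δ (bond-ℤ² at 1/2, largest component Ω_δ, discrete arcs) converges to F(η)
for every R. In the embedding used, P_{1/2,0}-open clusters of δG_s meeting a type-I site are
exactly the open bond clusters of δℤ² (type-III vertices open a.s., type-II face centres closed
a.s.), so the content is a Bollobás–Riordan Lemma-14 sandwich of Ω_δ between crude crossings of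
inner/outer approximating conformal rectangles plus continuity of F∘η in the domain (tree template:
tri_exists_discreteApprox_proof). [difficulty: L] -/
@[route_item "route-CriticalPhenomena-DWavePairKernel", crux]
def CoveringBridge : Prop :=
  let Z : Literature.Barriers.CriticalPhenomena.MixedSite → ℂ := fun v => Sum.elim (fun x : ℤ × ℤ => (((x.1 + x.2 : ℤ) : ℂ) + ((x.2 - x.1 + 1 : ℤ) : ℂ) * Complex.I) / 2) (fun f : ℤ × ℤ => (((f.1 + f.2 + 1 : ℤ) : ℂ) + ((f.2 + 1 - f.1 : ℤ) : ℂ) * Complex.I) / 2) v; let G : SimpleGraph Literature.Barriers.CriticalPhenomena.MixedSite := SimpleGraph.fromRel fun u v => ∃ x : ℤ × ℤ, u = Sum.inl x ∧ (v = Sum.inl (x.1 + 1, x.2) ∨ v = Sum.inl (x.1, x.2 + 1) ∨ ∃ f : ℤ × ℤ, v = Sum.inr f ∧ (x.1 = f.1 ∨ x.1 = f.1 + 1) ∧ (x.2 = f.2 ∨ x.2 = f.2 + 1)); let P : unitInterval → Literature.Probability.RandomPlanarGeometry.ConformalRectangle → ℝ → ℝ := fun q R δ => (Literature.Probability.LatticeModels.prodBernoulli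 (Literature.Barriers.CriticalPhenomena.mixedParam q)).real {ω | ∃ u v, Metric.infDist ((δ : ℂ) * Z u) (R.arc 0) ≤ 2 * δ ∧ Metric.infDist ((δ : ℂ) * Z v) (R.arc 2) ≤ 2 * δ ∧ ω ∈ Literature.Probability.Percolation.siteConnIn G {y | (δ : ℂ) * Z y ∈ R.carrier} u v}; (∀ R : Literature.Probability.RandomPlanarGeometry.ConformalRectangle, R.HasCrossingLimit (P 0 R) Literature.Probability.RandomPlanarGeometry.cardyFunction) → ∀ R : Literature.Probability.RandomPlanarGeometry.ConformalRectangle, R.HasCrossingLimit (Literature.Probability.Percolation.bondDomainCrossingProb R) Literature.Probability.RandomPlanarGeometry.cardyFunction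

/-- `CoveringBridge` holds: proved by `Summit.CriticalPhenomena.CardyFormulaZ2.Theorems.coveringBridge_proof` @ 511481cb7c86. -/
theorem CoveringBridge_holds : CoveringBridge := _root_.Summit.CriticalPhenomena.CardyFormulaZ2.Theorems.coveringBridge_proof

/-- item stmt-CriticalPhenomena-8376 · support · rank 7 · open · by planner
why it might fail: for smooth R it is RSW + boundary 3-arm counting (Beffara: 'RSW estimates are actually enough'), but for rough Jordan boundaries / marks at prime ends the crude 2δ-arc rule is lattice-position sensitive — the same hazard as CoveringBridge, met one item earlier.
sources: Beffara2008Universal, SchrammSmirnov2011, KestenPTM1982, Nolin2008, Literature.Probability.Percolation.QuadCrossing.SchrammSmirnov2011_lemma_6_1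
[crux] ODD LEVELS = bond-ℤ² against its own translate (card S2, Beffara's eq. (almost) summed): for
every conformal rectangle R, P_(1/2,1)[U_R^δ] − P_(1/2,0)[U_R^δ] → 0 as δ → 0⁺. Under q = 1 the open
G_s clusters through type-I sites are the open DUAL-lattice bond clusters, i.e. bond-ℤ² translated
by half a diagonal mesh (odd translation, tree mixedPi_map_mixedTranslate_of_odd), so this is
insensitivity of crude bond-ℤ² crossing probabilities to an O(δ) shift of the lattice relative to Ω;
it equals 2 Σ_(k odd) g^(k)(1/2)/(k! 2^k), all odd Walsh levels at once. [difficulty: L] -/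
@[route_item "route-CriticalPhenomena-DWavePairKernel", crux]
def OddShift : Prop :=
  let Z : Literature.Barriers.CriticalPhenomena.MixedSite → ℂ := fun v => Sum.elim (fun x : ℤ × ℤ => (((x.1 + x.2 : ℤ) : ℂ) + ((x.2 - x.1 + 1 : ℤ) : ℂ) * Complex.I) / 2) (fun f : ℤ × ℤ => (((f.1 + f.2 + 1 : ℤ) : ℂ) + ((f.2 + 1 - f.1 : ℤ) : ℂ) * Complex.I) / 2) v; let G : SimpleGraph Literature.Barriers.CriticalPhenomena.MixedSite := SimpleGraph.fromRel fun u v => ∃ x : ℤ × ℤ, u = Sum.inl x ∧ (v = Sum.inl (x.1 + 1, x.2) ∨ v = Sum.inl (x.1, x.2 + 1) ∨ ∃ f : ℤ × ℤ, v = Sum.inr f ∧ (x.1 = f.1 ∨ x.1 = f.1 + 1) ∧ (x.2 = f.2 ∨ x.2 = f.2 + 1)); let P : unitInterval → Literature.Probability.RandomPlanarGeometry.ConformalRectangle → ℝ → ℝ := fun q R δ => (Literature.Probability.LatticeModels.prodBernoulli (Literature.Barriers.CriticalPhenomena.mixedParam q)).real {ω | ∃ u v, Metric.infDist ((δ : ℂ)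 * Z u) (R.arc 0) ≤ 2 * δ ∧ Metric.infDist ((δ : ℂ) * Z v) (R.arc 2) ≤ 2 * δ ∧ ω ∈ Literature.Probability.Percolation.siteConnIn G {y | (δ : ℂ) * Z y ∈ R.carrier} u v}; ∀ R : Literature.Probability.RandomPlanarGeometry.ConformalRectangle, Tendsto (fun δ : ℝ => P 1 R δ - P 0 R δ) (𝓝[>] 0) (𝓝 0)

/-- item stmt-CriticalPhenomena-4561 · support · rank 9 · closed · proved by Summit.CriticalPhenomena.CardyFormulaZ2.Theorems.unionJackEndgame_proof (prover) · by planner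
sources: BollobasRiordan2006, Smirnov2001, Beffara2007
[support] UnionJackMorera → UnionJackCardy: Smirnov families sandwiching the crude G_s crossing
probability force it to converge to Carleson's ratio, hence (Carleson maps exist, Cardy–Carleson
identity) to cardyFunction(η) for every uniformizing datum. Verbatim copy of the tree's
smirnov_tendsto_triDomainCrossingProb_of_limitArgument +
hasCrossingLimit_triDomainCrossingProb_of_carleson with the proved facts
triangleIntegral_eq_zero_of_forall_lattice_holds, smirnov_claim24_holds, exists_isCarlesonMap_holds,
cardyFunction_crossRatio_eq_carlesonRatio_holds. [difficulty: provable-now] -/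
@[route_item "route-CriticalPhenomena-DWavePairKernel", crux]
def UnionJackEndgame : Prop :=
  let Z : Literature.Barriers.CriticalPhenomena.MixedSite → ℂ := fun v => Sum.elim (fun x : ℤ × ℤ => (((x.1 + x.2 : ℤ) : ℂ) + ((x.2 - x.1 + 1 : ℤ) : ℂ) * Complex.I) / 2) (fun f : ℤ × ℤ => (((f.1 + f.2 + 1 : ℤ) : ℂ) + ((f.2 + 1 - f.1 : ℤ) : ℂ) * Complex.I) / 2) v; let G : SimpleGraph Literature.Barriers.CriticalPhenomena.MixedSite := SimpleGraph.fromRel fun u v => ∃ x : ℤ × ℤ, u = Sum.inl x ∧ (v = Sum.inl (x.1 + 1, x.2) ∨ v = Sum.inl (x.1, x.2 + 1) ∨ ∃ f : ℤ × ℤ, v = Sum.inr f ∧ (x.1 = f.1 ∨ x.1 = f.1 + 1) ∧ (x.2 = f.2 ∨ x.2 = f.2 + 1)); let P : unitInterval → Literature.Probability.RandomPlanarGeometry.ConformalRectangle → ℝ → ℝ := fun q R δ => (Literature.Probability.LatticeModels.prodBernoulli (Literature.Barriers.CriticalPhenomena.mixedParam q)).real {ω | ∃ u v, Metric.infDist ((δ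 : ℂ) * Z u) (R.arc 0) ≤ 2 * δ ∧ Metric.infDist ((δ : ℂ) * Z v) (R.arc 2) ≤ 2 * δ ∧ ω ∈ Literature.Probability.Percolation.siteConnIn G {y | (δ : ℂ) * Z y ∈ R.carrier} u v}; (∀ (R : Literature.Probability.RandomPlanarGeometry.ConformalRectangle) (a b c d : ℂ) (ψ : Literature.Probability.RandomPlanarGeometry.ConformalEquiv R.carrier (Literature.Probability.Percolation.openTriangle a b c)), Literature.Probability.Percolation.IsEquilateral a b c → d ∈ openSegment ℝ c a → Literature.Probability.Percolation.IsCarlesonMap R a b c d ψ → ∃ δ₀ > (0 : ℝ), ∃ gm gp : ℝ → Fin 3 → ℂ → ℝ, Literature.Probability.Percolation.IsSmirnovFamily R a b c δ₀ gm ∧ Literature.Probability.Percolation.IsSmirnovFamily R a b c δ₀ gp ∧ ∃ (zm zp : ℝ → ℂ) (e : ℝ → ℝ), (∀ δ ∈ Set.Ioo 0 δ₀, zm δ ∈ R.carrier ∧ zp δ ∈ R.carrier) ∧ Tendsto zm (𝓝[>] 0) (𝓝 (R.pt 3)) ∧ Tendsto zp (𝓝[>] 0) (𝓝 (R.pt 3))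 ∧ Tendsto e (𝓝[>] 0) (𝓝 0) ∧ ∀ δ ∈ Set.Ioo 0 δ₀, gm δ 1 (zm δ) - e δ ≤ P Literature.Probability.Percolation.half R δ ∧ P Literature.Probability.Percolation.half R δ ≤ gp δ 1 (zp δ) + e δ) → ∀ R : Literature.Probability.RandomPlanarGeometry.ConformalRectangle, R.HasCrossingLimit (P Literature.Probability.Percolation.half R) Literature.Probability.RandomPlanarGeometry.cardyFunction

/-- `UnionJackEndgame` holds: proved by `Summit.CriticalPhenomena.CardyFormulaZ2.Theorems.unionJackEndgame_proof`. -/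
theorem UnionJackEndgame_holds : UnionJackEndgame := _root_.Summit.CriticalPhenomena.CardyFormulaZ2.Theorems.unionJackEndgame_proof

/-- item stmt-CriticalPhenomena-8377 · support · rank 9 · open · by planner
sources: Beffara2008Universal, GarbanPeteSchramm2010, Grimmett1999
[support] (E1) at level 2, the dictionary between the chain and the kernel: for every R and δ > 0,
g''(1/2) = 4 Σ_((v,w), v ≠ w) ε_v ε_w κ_R^δ(v, w) with ε_f = +1 on type II (f₁+f₂ even), −1 on type
III, κ as in PairKernelDWave (finitely supported: faces outside Ω have mean-zero colour independent
of U). Proof: U depends on the finitely many sites mapped into Ω; on that marginal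
dP_(1/2,1/2+h)/dP_(1/2,1/2) = Π_f (1 + 2hε_f σ_f), so g(1/2 + h) = Σ_S (2h)^|S| ε_S E_(1/2)[1_U σ_S]
(site-inhomogeneous Russo/Walsh over prodBernoulli (mixedParam q); tree RussoFormula.lean,
SiteRusso.lean for the homogeneous case). [difficulty: M] -/
@[route_item "route-CriticalPhenomena-DWavePairKernel", crux]
def WalshPairIdentity : Prop :=
  let Z : Literature.Barriers.CriticalPhenomena.MixedSite → ℂ := fun v => Sum.elim (fun x : ℤ × ℤ => (((x.1 + x.2 : ℤ) : ℂ) + ((x.2 - x.1 + 1 : ℤ) : ℂ) * Complex.I) / 2) (fun f : ℤ × ℤ => (((f.1 + f.2 + 1 : ℤ) : ℂ) + ((f.2 + 1 - f.1 : ℤ) : ℂ) * Complex.I) / 2) v; let G : SimpleGraph Literature.Barriers.CriticalPhenomena.MixedSite := SimpleGraph.fromRel fun u v => ∃ x : ℤ × ℤ, u = Sum.inl x ∧ (v = Sum.inl (x.1 + 1, x.2) ∨ v = Sum.inl (x.1, x.2 + 1) ∨ ∃ f : ℤ × ℤ, v = Sum.inr f ∧ (x.1 = f.1 ∨ x.1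 = f.1 + 1) ∧ (x.2 = f.2 ∨ x.2 = f.2 + 1)); let P : unitInterval → Literature.Probability.RandomPlanarGeometry.ConformalRectangle → ℝ → ℝ := fun q R δ => (Literature.Probability.LatticeModels.prodBernoulli (Literature.Barriers.CriticalPhenomena.mixedParam q)).real {ω | ∃ u v, Metric.infDist ((δ : ℂ) * Z u) (R.arc 0) ≤ 2 * δ ∧ Metric.infDist ((δ : ℂ) * Z v) (R.arc 2) ≤ 2 * δ ∧ ω ∈ Literature.Probability.Percolation.siteConnIn G {y | (δ : ℂ) * Z y ∈ R.carrier} u v}; let κ : Literature.Probability.RandomPlanarGeometry.ConformalRectangle → ℝ → ℤ × ℤ → ℤ × ℤ → ℝ := fun R δ v w => ∫ ω, Set.indicator {ω | ∃ u v, Metric.infDist ((δ : ℂ) * Z u) (R.arc 0) ≤ 2 * δ ∧ Metric.infDist ((δ : ℂ) * Z v) (R.arc 2) ≤ 2 * δ ∧ ω ∈ Literature.Probability.Percolation.siteConnIn G {y | (δ : ℂ) * Z y ∈ R.carrier} u v} (fun _ => (1 : ℝ)) ω * ((if Sum.inr v ∈ ω then (1 : ℝ) else -1) * (if Sum.inr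 w ∈ ω then (1 : ℝ) else -1)) ∂(Literature.Probability.LatticeModels.prodBernoulli (Literature.Barriers.CriticalPhenomena.mixedParam Literature.Probability.Percolation.half)); let ε : ℤ × ℤ → ℝ := fun f => if Even (f.1 + f.2) then 1 else -1; ∀ (R : Literature.Probability.RandomPlanarGeometry.ConformalRectangle) (δ : ℝ), 0 < δ → iteratedDeriv 2 (fun t : ℝ => P (Set.projIcc (0 : ℝ) 1 zero_le_one t) R δ) (1 / 2) = 4 * ∑' p : (ℤ × ℤ) × (ℤ × ℤ), (if p.1 = p.2 then (0 : ℝ) else ε p.1 * ε p.2 * κ R δ p.1 p.2)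

/-- item stmt-CriticalPhenomena-14561 · support · rank 10 · open · by planner
sources: Beffara2008Universal
[support] [glue] legs → Target: UnionJackEndgame applied to UnionJackMorera is the fourth conjunct
of X = Target (UnionJackCardy: Cardy's formula for the crude P_(1/2,1/2) site crossing of every
conformal rectangle on δG_s) and the three symmetric-point flatness statements SecondOrderNode,
EvenTail, OddShift are its first three conjuncts verbatim. Pure logic once the shared `let Z G P`
prefix is zeta-reduced (fun d e a b c => And.intro a (And.intro b (And.intro c (e d))); checked rc0
in the rbadge repair planner's Sketch2.lean as targetFromCruxes_provable). Rank 10 so the gate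
renders it after the rank-9 support UnionJackEndgame it quotes. Purpose: an item DERIVES the rank-0
Target (badge route.target-unreachable; without it the gate auto-cruxes Target as an underived
closes hypothesis). RE-FILED 2026-08-16T04:0xZ after a drop race between two repair seats (rbadge
3547561a dropped this item in favour of TargetGlue stmt-14545 while rchoice d761f8f5 dropped 14545
in favour of this one, leaving no glue at rev 7). PROTOCOL from here: ADD-ONLY — if a twin glue item
(TargetGlue) reappears, leave both; de-duplication is ONE tenure/retriage seat's call, never a
concurrent drop. The Assembl -/
@[route_item "route-CriticalPhenomena-DWavePairKernel"]
def TargetFromCruxes : Prop :=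
  UnionJackMorera → UnionJackEndgame → SecondOrderNode → EvenTail → OddShift → Target

/-- item stmt-CriticalPhenomena-8378 · assembly · rank 1 · open · by planner
sources: Beffara2008Universal, Smirnov2001, BollobasRiordan2006
[assembly] SecondOrderNode → EvenTail → OddShift → UnionJackMorera → UnionJackEndgame →
CoveringBridge → CardyFormulaZ2. -/
@[route_item "route-CriticalPhenomena-DWavePairKernel", crux]
def Assembly : Prop :=
  SecondOrderNode → EvenTail → OddShift → UnionJackMorera → UnionJackEndgame → CoveringBridge → CardyFormulaZ2

/-! D-0027 §2.1 — DECIDING THEOREM (planner-authored via `route open/edit --closes-file`; by operator:999:2941348 2026-08-15T15:21:16Z):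
its hypotheses are this route's items and its conclusion the sub-problem Statement (glue_lint), and it elaborates with this file. -/

@[closes "route-CriticalPhenomena-DWavePairKernel"] theorem closes : Target → PairKernelDWave → SecondOrderNode → EvenTail → UnionJackMorera → CoveringBridge → OddShift → UnionJackEndgame → WalshPairIdentity → Assembly → _root_.CardyFormulaZ2 := fun h_Target h_PairKernelDWave h_SecondOrderNode h_EvenTail h_UnionJackMorera h_CoveringBridge h_OddShift h_UnionJackEndgame h_WalshPairIdentity h_Assembly => h_Assembly h_SecondOrderNode h_EvenTail h_OddShift h_UnionJackMorera h_UnionJackEndgame h_CoveringBridge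

end Summit.CriticalPhenomena.CardyFormulaZ2.Theses.DWavePairKernel
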